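import Mathlib
import Summits.NavierStokesRegularity.NavierStokesRegularity.Theorems.TypeIQuarterGateScarEnvelopeTypeISatelliteTowerGalleryRecurrence
import Summits.NavierStokesRegularity.NavierStokesRegularity.Theorems.TypeIQuarterGateScarEnvelopeTypeISatelliteTowerGalleryMinimalSet
import Summits.NavierStokesRegularity.NavierStokesRegularity.Theorems.TypeIQuarterGateScarEnvelopeTypeISatelliteTowerRootMeter
import Summits.NavierStokesRegularity.NavierStokesRegularity.Theorems.TypeIQuarterGateScarEnvelopeTypeISatelliteTowerRootCensus
import Summits.NavierStokesRegularity.NavierStokesRegularity.Theorems.TypeIQuarterGateScarEnvelopeTypeISatelliteTowerCensus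

/-!
# The FIXED-POINT NORMAL FORM is a theorem: enveloped leaf OR a self-descending recurrent node

Rung (L7) `FixedPointNormalForm` of the crux idea `Cruxes/ScarEnvelopeTypeI/Ideas/zoom-recurrence.md`
(ns-idea-17 g0) on the crux `TypeIQuarterGate.ScarEnvelopeTypeI` (item 23843) — UNCONDITIONAL, in
the tree's vocabulary (`RootObj`, `TameRoot`, `RootDescends`, `EnvelopedLeaf`):

* (module `…GalleryMinimalSet`: `exists_minimal_set` — Birkhoff MINIMAL SETS of a continuous
  `(0,1]`-semigroup action on a nonempty compact space.)
* ★★ `ABTower.envelopedLeaf_or_selfDescending` — THE ROOT DICHOTOMY WITH RECURRENCE: every ROOTED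
  A–B object `U` of rate `M` yields EITHER an enveloped leaf of rate `M`, OR a node `n` with
  `RootObj M n ∧ ¬ TameRoot n ∧ RootDescends n n` (a SELF-DESCENDING NODE: the field is a tangent
  flow of ITSELF at its own root and carries a sphere satellite at `‖n.y‖ = 1/4`), which moreover is
  a gallery limit of `U` with budget `≤ 4·𝐈(U)`, root-recurrent, and an exact globally equi-rated
  minimiser (class `ABTower m⋆`, all scars exactly `m⋆`-rated, `m⋆` minimal over the gallery).
  Proof: the phase space of exact minimisers (module `…GalleryRecurrence`) carries a Birkhoff minimal
  set `𝓜`; if some point of `𝓜` is TAME at the root, `envelopedLeaf_of_tameRoot`; otherwise the root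
  meter `ABTower.not_budgetAt_iff_sphere` (κ = 4) puts a scar on the sphere `‖z‖ = 1/4` of a root
  tangent of a point of `𝓜`; its A–B representative is again in `𝓜` (closed, invariant), hence
  recurrent, and a `TangentU` along a subsequence of its return scales (`i1_of_suitableCompactness`)
  is a.e. the field itself — `RootDescends n n`.
* `fixedPointNormalForm` — the card's (L7) verbatim up to vocabulary:
  `InfiniteRootDescent M → (∃ A, EnvelopedLeaf M A) ∨ ∃ n, RootObj M n ∧ ¬ TameRoot n ∧ RootDescends n n`.
* ★★★ `scarEnvelopeTypeI_of_noEnvelopedLeaf_noSelfDescending` — NEW KERNEL REDUCTION of 23843, by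
  name: `(∀ M A, ¬ EnvelopedLeaf M A) → (∀ M n, RootObj M n → ¬ TameRoot n → ¬ RootDescends n n) →
  Theses.TypeIQuarterGate.ScarEnvelopeTypeI` — the infinite-descent exclusion (E2) of
  `scarEnvelopeTypeI_of_noEnvelopedLeaf_noDescent` replaced by the exclusion of ONE self-descending
  (root-recurrent, exact, equi-rated) node.

HONEST FRAMING: a NORMAL FORM / REDUCTION (H3 wall movement 0): the residual «no self-descending
node» ⊇ «no λ-DSS A–B object with an off-root sphere scar» is a face of the same Type-I ancient
Liouville wall; nothing open is proved — 23843, `∀ M A, ¬ EnvelopedLeaf M A`, the self-descending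
exclusion, the route and Navier–Stokes regularity are OPEN.  LEAD-lineage prover ns-sz-p1 g6;
`--supports stmt-NavierStokesRegularity-23843 --as helper`.
-/

noncomputable section

-- the summit-side namespace repeats a component by design (single-conjunct summit, D-0017)
set_option linter.dupNamespace false

open MeasureTheory Set Metric Filter Topology
open scoped ENNReal

namespace Summit.NavierStokesRegularity.NavierStokesRegularity.Cruxes.ScarEnvelopeTypeI.ZoomDictionary

/-! ### The root dichotomy with recurrence -/

section NormalForm

open Literature.Analysis.FluidPDE
variable {U : ℝ → (EuclideanSpace ℝ (Fin 3)) → (EuclideanSpace ℝ (Fin 3))}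
  {P : ℝ → (EuclideanSpace ℝ (Fin 3)) → ℝ}
  {H : ℝ → (EuclideanSpace ℝ (Fin 3)) → (EuclideanSpace ℝ (Fin 3)) →L[ℝ] (EuclideanSpace ℝ (Fin 3))}
  {M : ℝ}

/-- **Tangent flows along a PRESCRIBED null sequence** (up to a subsequence): for a tower object and
any positive null scales `l`, a `TangentU` exists along a subsequence of `l` (the tree's
`i1_of_suitableCompactness`, fed with `l / c₀`, read through `tangentU_tshift_iff`). -/
theorem exists_tangentU_along {P : ℝ → (EuclideanSpace ℝ (Fin 3)) → ℝ} (h : TowerObj M U P)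
    (y' : (EuclideanSpace ℝ (Fin 3))) {l : ℕ → ℝ} (hl : ∀ k, 0 < l k) (hl0 : Tendsto l atTop (𝓝 0)) :
    ∃ φ : ℕ → ℕ, StrictMono φ ∧
      ∃ Ū : ℝ → (EuclideanSpace ℝ (Fin 3)) → (EuclideanSpace ℝ (Fin 3)), TangentU U P y' 0 (l ∘ φ) Ū := by
  obtain ⟨-, -, hZ, hB⟩ := h.inputs y'
  have hpos : ∀ k, 0 < l k / c₀ := fun k => div_pos (hl k) c₀_pos
  have hlim : Tendsto (fun k => l k / c₀) atTop (𝓝 0) := by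
    simpa using hl0.div_const c₀
  obtain ⟨φ, hφ, ū, hū⟩ := i1_of_suitableCompactness hZ hB (fun k => l k / c₀) hpos hlim
  have hū' : TangentU (tshift U) (tshift P) y' 1 (fun k => c₀ * (((fun k => l k / c₀) ∘ φ) k)) ū := hū
  have e : (fun k => c₀ * (((fun k => l k / c₀) ∘ φ) k)) = l ∘ φ := by
    funext k
    simp only [Function.comp_apply]
    rw [mul_div_cancel₀ _ c₀_pos.ne']
  rw [e] at hū'
  exact ⟨φ, hφ, ū, tangentU_tshift_iff.1 hū'⟩

/-- A globally `m`-rated field is `m`-rated on the unit cylinder. -/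
theorem unitRate_of_hasTypeITimeDecay {W : ℝ → (EuclideanSpace ℝ (Fin 3)) → (EuclideanSpace ℝ (Fin 3))}
    {m : ℝ} (h : HasTypeITimeDecay m W) :
    ∀ s ∈ Ioo (-((1 : ℝ) ^ 2)) 0, ∀ z ∈ ball (0 : (EuclideanSpace ℝ (Fin 3))) 1,
      Real.sqrt (-s) * ‖W s z‖ ≤ m := by
  intro s hs z _
  have hs0 : s < 0 := hs.2
  have hst : 0 < Real.sqrt (-s) := Real.sqrt_pos.2 (neg_pos.2 hs0)
  have h1 := h s hs0 z
  rwa [le_div_iff₀ hst, mul_comm] at h1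

/-- ★★ **THE ROOT DICHOTOMY WITH RECURRENCE (fixed-point normal form, unconditional).**  Every
ROOTED A–B object `U` of rate `M` yields EITHER an enveloped leaf of rate `M`, OR a SELF-DESCENDING
NODE `n` — `RootObj M n`, NOT tame at the root, `RootDescends n n` (its field is a tangent flow of
itself at its own root, with a sphere satellite `‖n.y‖ = 1/4`) — whose field is moreover a gallery
limit of `U` with budget `≤ 4·𝐈(U)`, root-recurrent, and an exact globally equi-rated minimiser of
the gallery (class `ABTower m⋆`, `m⋆ ≤ tightRate U 0`, every scar exactly `m⋆`-rated, `m⋆` minimal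
over all scars of all A–B gallery limits of `U`). -/
theorem ABTower.envelopedLeaf_or_selfDescending (hU : ABTower M U P H) (h0 : ¬ RegPt U 0) :
    (∃ A : ℝ, EnvelopedLeaf M A) ∨
    ∃ n : TNode, RootObj M n ∧ ¬ TameRoot n ∧ RootDescends n n ∧
      IsGalleryLimit U n.U ∧
      typeIBound (Iio (0 : ℝ) ×ˢ univ) n.U n.P n.H ≤ 4 * typeIBound (Iio (0 : ℝ) ×ˢ univ) U P H ∧
      IsRootOmegaLimit n.U n.U ∧
      ∃ mstar : ℝ, ABTower mstar n.U n.P n.H ∧ mstar ≤ tightRate U 0 ∧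
        (∀ y : (EuclideanSpace ℝ (Fin 3)), ¬ RegPt n.U y → tightRate n.U y = mstar) ∧
        ∀ (W₂ : ℝ → (EuclideanSpace ℝ (Fin 3)) → (EuclideanSpace ℝ (Fin 3))) (P₂ : ℝ → (EuclideanSpace ℝ (Fin 3)) → ℝ)
          (H₂ : ℝ → (EuclideanSpace ℝ (Fin 3)) → (EuclideanSpace ℝ (Fin 3)) →L[ℝ] (EuclideanSpace ℝ (Fin 3)))
          (y₂ : (EuclideanSpace ℝ (Fin 3))),
          ABTower M W₂ P₂ H₂ → IsGalleryLimit U W₂ → ¬ RegPt W₂ y₂ → mstar ≤ tightRate W₂ y₂ := by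
  classical
  have hUmeas : ∀ R : ℝ, 0 < R → AEStronglyMeasurable (Function.uncurry U)
      (volume.restrict (parabolicCylinder R (0 : ℝ × (EuclideanSpace ℝ (Fin 3))))) :=
    fun R hR => hU.aestronglyMeasurable_uncurry hR
  -- ## the exact minimiser and the phase space at its rate `m⋆`
  obtain ⟨W₀, P₀, H₀, mstar, hW₀, hW₀m, hg₀, hI₀, hs₀, hmU, -, -, hmin⟩ :=
    hU.exists_galleryExactMinimiser h0
  have hphase₀ : ExactPhase M mstar U P H W₀ := ⟨⟨P₀, H₀, hW₀, hI₀⟩, hW₀m.1.2.2.2, hg₀, hs₀⟩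
  letI : PseudoMetricSpace (PhasePt M mstar U P H) := PhasePt.pseudoMetricSpace M mstar U P H
  haveI : Nonempty (PhasePt M mstar U P H) := ⟨⟨W₀, hphase₀⟩⟩
  have hdist : ∀ a b : PhasePt M mstar U P H, dist a b = galleryDist a.W b.W := fun a b => rfl
  have hseq : IsSeqCompact (univ : Set (PhasePt M mstar U P H)) := by
    intro x _
    obtain ⟨W', σ, hσ, hW', hconv⟩ := ExactPhase.exists_seqLimit hU (fun j => (x j).mem)
    refine ⟨⟨W', hW'⟩, mem_univ _, σ, hσ, ?_⟩
    rw [tendsto_iff_dist_tendsto_zero]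
    simp only [Function.comp_apply, hdist]
    exact tendsto_galleryDist_of_tendsto hconv
  haveI : CompactSpace (PhasePt M mstar U P H) := ⟨isCompact_iff_isSeqCompact.2 hseq⟩
  -- ## the root-zoom semiflow and a Birkhoff minimal set
  set T : ℝ → PhasePt M mstar U P H → PhasePt M mstar U P H :=
    fun l a => if hl : 0 < l then ⟨zoom a.W 0 0 l, a.mem.rootZoom hl⟩ else a with hTdef
  have hTpos : ∀ {l : ℝ} (hl : 0 < l) (a : PhasePt M mstar U P H),
      T l a = ⟨zoom a.W 0 0 l, a.mem.rootZoom hl⟩ := fun hl a => by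
    simp only [hTdef, dif_pos hl]
  have hcont : ∀ l : ℝ, 0 < l → l ≤ 1 → Continuous (T l) := by
    intro l hl hl1
    set K : ℝ := max 1 (‖l‖ₑ * (ENNReal.ofReal (l ^ 2 * l ^ 3)⁻¹) ^ (1 / (3 : ℝ≥0∞).toReal)).toReal
      with hKdef
    have hK : 0 ≤ K := le_max_of_le_left zero_le_one
    refine (LipschitzWith.of_dist_le_mul (K := K.toNNReal) fun a b => ?_).continuous
    rw [hTpos hl, hTpos hl, hdist, hdist, Real.coe_toNNReal _ hK]
    exact galleryDist_rootZoom_le a.mem.l3loc b.mem.l3loc hl hl1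
  have hmul : ∀ l μ : ℝ, 0 < l → l ≤ 1 → 0 < μ → μ ≤ 1 →
      ∀ a : PhasePt M mstar U P H, T l (T μ a) = T (l * μ) a := by
    intro l μ hl _ hμ _ a
    rw [hTpos hμ, hTpos hl, hTpos (mul_pos hl hμ)]
    congr 1
    rw [zoom_zoom_centre, smul_zero, add_zero, mul_comm]
  obtain ⟨Mset, hMne, hMcl, hMinv, hMomega⟩ := exists_minimal_set T hcont hmul
  have hkpos : ∀ k : ℕ, (0 : ℝ) < 1 / ((k : ℝ) + 1) := fun k => by positivity
  -- recurrence of every point of the minimal set, in gallery terms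
  have hrec : ∀ b ∈ Mset, ∃ l : ℕ → ℝ, (∀ k, 0 < l k) ∧ Tendsto l atTop (𝓝 0) ∧
      ZoomsTendsto b.W (fun _ => 0) l b.W := by
    intro b hb
    have hbω : ∀ k : ℕ, b ∈ closure {y : PhasePt M mstar U P H |
        ∃ l : ℝ, 0 < l ∧ l ≤ 1 / ((k : ℝ) + 1) ∧ y = T l b} := fun k => by
      have h := hb
      rw [← hMomega b hb] at h
      exact mem_iInter.1 h k
    have hret : ∀ k : ℕ, ∃ l : ℝ, 0 < l ∧ l ≤ 1 / ((k : ℝ) + 1) ∧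
        galleryDist (zoom b.W 0 0 l) b.W < 1 / ((k : ℝ) + 1) := by
      intro k
      obtain ⟨y, ⟨l, hl, hlk, rfl⟩, hd⟩ := Metric.mem_closure_iff.1 (hbω k) _ (hkpos k)
      refine ⟨l, hl, hlk, ?_⟩
      rwa [hdist, hTpos hl, galleryDist_comm] at hd
    choose l hl hlk hld using hret
    have hl0 : Tendsto l atTop (𝓝 0) :=
      squeeze_zero (fun k => (hl k).le) hlk tendsto_one_div_add_atTop_nhds_zero_nat
    have hdl : Tendsto (fun k => galleryDist (zoom b.W 0 0 (l k)) b.W) atTop (𝓝 0) :=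
      squeeze_zero (fun k => galleryDist_nonneg _ _) (fun k => (hld k).le)
        tendsto_one_div_add_atTop_nhds_zero_nat
    exact ⟨l, hl, hl0, fun R hR =>
      tendsto_of_tendsto_galleryDist (fun k => (b.mem.rootZoom (hl k)).l3loc) b.mem.l3loc hdl hR⟩
  -- ## the dichotomy on the minimal set
  by_cases hα : ∃ a ∈ Mset, BudgetAt 1 0 a.W 0
  · -- (α) a tame point: an enveloped leaf of rate `M`
    obtain ⟨a, -, hb⟩ := hα
    obtain ⟨⟨Pa, Ha, hABa, -⟩, -, -, hsa⟩ := a.mem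
    exact Or.inl (envelopedLeaf_of_tameRoot hABa hsa hb)
  · -- (β) no tame point
    push Not at hα
    right
    obtain ⟨a, haM⟩ := hMne
    obtain ⟨⟨Pa, Ha, hABa, hIa⟩, hdeca, hga, hsa⟩ := a.mem
    -- the root meter: a sphere scar on a root tangent of `a`
    obtain ⟨L, Ū, hŪ, z, hz, hzsing⟩ :=
      (hABa.not_budgetAt_iff_sphere 0 (by norm_num : (1 : ℝ) < 4)).1 (hα a haM)
    obtain ⟨hLpos, hL0, pbar, hTR⟩ := hŪ
    have hz4 : ‖z‖ = 1 / 4 := by rw [hz]; norm_num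
    have hz1 : ‖z‖ < 1 := by rw [hz4]; norm_num
    have hz0 : z ≠ 0 := by
      intro hz0'
      rw [hz0', norm_zero] at hz4
      norm_num at hz4
    -- a root ω-limit `W₁` of `a.W` along a subsequence of `L`, a.e. equal to `Ū` on `Q_R`, `R < 1`
    obtain ⟨W₁, P₁, H₁, σ, hσ, hW₁, -, hω₁, hconv₁⟩ := hABa.exists_isRootOmegaLimit hLpos hL0
    have hae₁ : ∀ R ∈ Ioo (0 : ℝ) 1,
        ∀ᵐ w ∂(volume.restrict (parabolicCylinder R (0 : ℝ × (EuclideanSpace ℝ (Fin 3))))),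
          Ū w.1 w.2 = W₁ w.1 w.2 := by
      intro R hR
      obtain ⟨-, hŪmem, hconvŪ, -⟩ := hTR R hR
      have hmeasv : ∀ j, AEStronglyMeasurable (Function.uncurry (zoom a.W 0 0 (L (σ j))))
          (volume.restrict (parabolicCylinder R (0 : ℝ × (EuclideanSpace ℝ (Fin 3))))) := fun j =>
        aestronglyMeasurable_zoom_of_inBall hABa.2.1 0 (hLpos _) hR.1
      have h := ae_eq_of_tendsto_eLpNorm_three hmeasv hŪmem.1 (hω₁.1 R hR.1).1
        (hconvŪ.comp hσ.tendsto_atTop) (hconv₁ R hR.1)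
      exact h.mono fun w hw => hw
    have hW₁z : ¬ RegPt W₁ z := fun hr => hzsing ((regPt_iff_of_ae_eq_of_norm_lt_one hae₁ hz1).2 hr)
    -- its exact-minimiser representative `W₂`: a point `b` of the phase space
    have hgW₁ : IsGalleryLimit U W₁ := hga.trans hUmeas hω₁.isGalleryLimit
    obtain ⟨W₂, P₂, H₂, hAB₂, hI₂, hae₂⟩ := abTower_of_isGalleryLimit hU hgW₁
    obtain ⟨U₁, -, -, -, -, hae₁', hU₁0⟩ := abTower_of_isRootOmegaLimit hABa hsa hω₁
    have hW₁0 : ¬ RegPt W₁ 0 := fun hr => hU₁0 (regPt_zero_of_ae_eq hr hae₁')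
    have hs₂ : ¬ RegPt W₂ 0 := fun hr =>
      hW₁0 (regPt_zero_of_ae_eq hr fun R hR => (hae₂ R hR).mono fun w hw => hw.symm)
    have hcont₂ : ContinuousOn (Function.uncurry W₂) (Iio 0 ×ˢ univ) := (towerObj_of_abTower hAB₂).2.1
    have hdec₂ : HasTypeITimeDecay mstar W₂ := by
      refine hasTypeITimeDecay_of_ae_rate hcont₂ fun R hR => ?_
      filter_upwards [globalRate_ae_of_isRootOmegaLimit (unitRate_of_hasTypeITimeDecay hdeca)
        (fun R hR => hABa.aestronglyMeasurable_uncurry hR) hω₁ hR, hae₂ R hR] with w hw hww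
      rw [← hww]
      exact hw
    have hg₂ : IsGalleryLimit U W₂ := hgW₁.congr_ae hae₂
    have hphase₂ : ExactPhase M mstar U P H W₂ := ⟨⟨P₂, H₂, hAB₂, hI₂⟩, hdec₂, hg₂, hs₂⟩
    set b : PhasePt M mstar U P H := ⟨W₂, hphase₂⟩ with hbdef
    -- `b` lies in the minimal set: it is a limit of root zooms of `a` with vanishing scales
    have hbM : b ∈ Mset := by
      rw [← hMomega a haM]
      refine mem_iInter.2 fun k => ?_
      have hconv₂ : ∀ R : ℝ, 0 < R → Tendsto (fun j => eLpNorm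
          (Function.uncurry (zoom a.W 0 0 (L (σ j))) - Function.uncurry W₂) 3
          (volume.restrict (parabolicCylinder R (0 : ℝ × (EuclideanSpace ℝ (Fin 3)))))) atTop (𝓝 0) := by
        intro R hR
        refine (hconv₁ R hR).congr fun j => eLpNorm_congr_ae ?_
        refine (hae₂ R hR).mono fun w hw => ?_
        have hw' : Function.uncurry W₁ w = Function.uncurry W₂ w := hw
        simp only [Pi.sub_apply, hw', Function.comp_apply]
      have htend : Tendsto (fun j => T (L (σ j)) a) atTop (𝓝 b) := by
        rw [tendsto_iff_dist_tendsto_zero]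
        have e : (fun j => dist (T (L (σ j)) a) b) = fun j => galleryDist (zoom a.W 0 0 (L (σ j))) W₂ := by
          funext j
          rw [hTpos (hLpos _), hdist]
        rw [e]
        exact tendsto_galleryDist_of_tendsto hconv₂
      refine mem_closure_of_tendsto htend ?_
      have hev : ∀ᶠ j in atTop, L (σ j) ≤ 1 / ((k : ℝ) + 1) :=
        (hL0.comp hσ.tendsto_atTop).eventually (Iic_mem_nhds (hkpos k))
      exact hev.mono fun j hj => ⟨L (σ j), hLpos _, hj, rfl⟩
    -- `b` is recurrent: return scales `l`
    obtain ⟨l, hl, hl0, hzt⟩ := hrec b hbM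
    have hωb : IsRootOmegaLimit W₂ W₂ := ⟨hphase₂.l3loc, l, hl, hl0, hzt⟩
    -- a tangent flow along a subsequence of the return scales is a.e. the field itself
    obtain ⟨φ, hφ, Ūb, hŪb⟩ := exists_tangentU_along (towerObj_of_abTower hAB₂) 0 hl hl0
    have haeb : ∀ R ∈ Ioo (0 : ℝ) 1,
        ∀ᵐ w ∂(volume.restrict (parabolicCylinder R (0 : ℝ × (EuclideanSpace ℝ (Fin 3))))),
          Ūb w.1 w.2 = W₂ w.1 w.2 := by
      intro R hR
      obtain ⟨-, -, pb, hTRb⟩ := hŪb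
      obtain ⟨-, hŪbmem, hconvb, -⟩ := hTRb R hR
      have hmeasv : ∀ j, AEStronglyMeasurable (Function.uncurry (zoom W₂ 0 0 ((l ∘ φ) j)))
          (volume.restrict (parabolicCylinder R (0 : ℝ × (EuclideanSpace ℝ (Fin 3))))) := fun j =>
        aestronglyMeasurable_zoom_of_inBall hAB₂.2.1 0 (hl _) hR.1
      have h := ae_eq_of_tendsto_eLpNorm_three hmeasv hŪbmem.1 (hphase₂.l3loc R hR.1).1 hconvb
        ((hzt R hR.1).comp hφ.tendsto_atTop)
      exact h.mono fun w hw => hw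
    have hW₂z : ¬ RegPt W₂ z := fun hr =>
      hW₁z ((regPt_iff_of_ae_eq_of_norm_lt_one (fun R hR => hae₂ R hR.1) hz1).2 hr)
    -- ## the self-descending node
    have hscar : ∀ y : (EuclideanSpace ℝ (Fin 3)), ¬ RegPt W₂ y → tightRate W₂ y = mstar := fun y hy =>
      le_antisymm (tightRate_le_of_rateAt (rateAt_of_hasTypeITimeDecay hdec₂ y))
        (hmin W₂ P₂ H₂ y hAB₂ hg₂ hy)
    have hAB₂m : ABTower mstar W₂ P₂ H₂ :=
      ⟨⟨hAB₂.1.1, hAB₂.1.2.1, hAB₂.1.2.2.1, hdec₂⟩, hAB₂.2.1, hAB₂.2.2.1, hAB₂.2.2.2⟩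
    refine ⟨⟨W₂, P₂, H₂, z⟩, ⟨hAB₂, hs₂⟩, hα b hbM, ⟨l ∘ φ, Ūb, hŪb, haeb, hz4, hz0, hW₂z⟩,
      hg₂, hI₂, hωb, mstar, hAB₂m, hmU, hscar, hmin⟩

/-- **The card's (L7) `FixedPointNormalForm`, PROVED** (tree vocabulary): an infinite root descent of
rate `M` forces an enveloped leaf of rate `M` or a self-descending node of rate `M`. -/
theorem fixedPointNormalForm (M : ℝ) (h : InfiniteRootDescent M) :
    (∃ A : ℝ, EnvelopedLeaf M A) ∨ ∃ n : TNode, RootObj M n ∧ ¬ TameRoot n ∧ RootDescends n n := by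
  obtain ⟨c, hc⟩ := h
  obtain ⟨⟨hAB, h0⟩, -, -⟩ := hc 0
  rcases hAB.envelopedLeaf_or_selfDescending h0 with hE | ⟨n, hn, ht, hd, -⟩
  · exact Or.inl hE
  · exact Or.inr ⟨n, hn, ht, hd⟩

/-- ★★★ **NEW KERNEL REDUCTION of 23843 `ScarEnvelopeTypeI`, by name**: the crux follows from the
exclusion of ENVELOPED LEAVES (E1⁺) and the exclusion of a single SELF-DESCENDING NODE
(`RootObj M n ∧ ¬ TameRoot n ∧ RootDescends n n` — by `ABTower.envelopedLeaf_or_selfDescending`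
it may be taken root-recurrent, exact and globally equi-rated); compare
`scarEnvelopeTypeI_of_noEnvelopedLeaf_noDescent` (exclusion of INFINITE descents). -/
theorem scarEnvelopeTypeI_of_noEnvelopedLeaf_noSelfDescending
    (hE : ∀ M A : ℝ, ¬ EnvelopedLeaf M A)
    (hS : ∀ (M : ℝ) (n : TNode), RootObj M n → ¬ TameRoot n → ¬ RootDescends n n) :
    Summit.NavierStokesRegularity.NavierStokesRegularity.Theses.TypeIQuarterGate.ScarEnvelopeTypeI := by
  by_contra h
  obtain ⟨M, U, P, H, e, hAB, -, h0, -, -⟩ := exists_abTower_of_not_scarEnvelopeTypeI h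
  rcases hAB.envelopedLeaf_or_selfDescending h0 with ⟨A, hA⟩ | ⟨n, hn, ht, hd, -⟩
  · exact hE M A hA
  · exact hS M n hn ht hd

/-- **Census form of the new reduction**: if 23843 fails, then EITHER an enveloped leaf exists OR a
ROOT-RECURRENT, exact, globally equi-rated SELF-DESCENDING node exists (with all the extras of
`ABTower.envelopedLeaf_or_selfDescending`, relative to some rooted A–B object of the portfolio). -/
theorem envelopedLeaf_or_selfDescending_of_not_scarEnvelopeTypeI
    (h : ¬ Summit.NavierStokesRegularity.NavierStokesRegularity.Theses.TypeIQuarterGate.ScarEnvelopeTypeI) :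
    (∃ M A : ℝ, EnvelopedLeaf M A) ∨
    ∃ (M : ℝ) (n : TNode), RootObj M n ∧ ¬ TameRoot n ∧ RootDescends n n ∧
      IsRootOmegaLimit n.U n.U ∧
      ∃ mstar : ℝ, ABTower mstar n.U n.P n.H ∧
        ∀ y : (EuclideanSpace ℝ (Fin 3)), ¬ RegPt n.U y → tightRate n.U y = mstar := by
  obtain ⟨M, U, P, H, e, hAB, -, h0, -, -⟩ := exists_abTower_of_not_scarEnvelopeTypeI h
  rcases hAB.envelopedLeaf_or_selfDescending h0 with ⟨A, hA⟩ | ⟨n, hn, ht, hd, -, -, hω, m, hm, -, hsc, -⟩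
  · exact Or.inl ⟨M, A, hA⟩
  · exact Or.inr ⟨M, n, hn, ht, hd, hω, m, hm, hsc⟩

end NormalForm

end Summit.NavierStokesRegularity.NavierStokesRegularity.Cruxes.ScarEnvelopeTypeI.ZoomDictionary
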